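import Mathlib
import HarnessLib
import Summits.ValiantsHypothesis.ValiantsHypothesis.Theses.MonotoneRestoration
import Summits.ValiantsHypothesis.ValiantsHypothesis.Theorems.MonotoneRestorationMonotoneRestorationQPEpsilonComplex

/-!
# Line `disc_ladder` — the DISCRIMINANT LADDER for `MonotoneRestorationQP` (stmt-ValiantsHypothesis-15886)

Forward generator G4 (ladder-down), seat `planner-fwd-ladder-ValiantsHypothesis-53`.

**Top.** By THEOREM ε (`monotoneRestorationQP_iff_complexRestorationQP`, p155888) the crux is
`ComplexRestorationQP`: every matrix-symmetric `VP` family over `ℂ` has square-symmetric circuits of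
quasi-polynomial size.  The crux ⇒ `ValiantsHypothesis` is the route's `closes`; the converse is not known
(strengthening top).

**Gradation (denominator co-rank).** For `k : ℕ → ℕ` let `D_{k,n} := det H_{k(n)}(p(R)) · det H_{k(n)}(p(C))`,
the product of the `k × k` HANKEL DETERMINANTS of the power sums of the row sums `R_i = Σ_j x_ij` and of the
column sums `C_j = Σ_i x_ij`.  By Cauchy–Binet `det H_k(p(R)) = Σ_{|S| = k} Π_{i<i' ∈ S} (R_i − R_i')²` — the
`k`-th ELEMENTARY DISCRIMINANT of the row sums: it is matrix-symmetric, symmetric-cheap, non-zero exactly at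
the matrices with `≥ k` distinct row sums, equal to `Disc(R_1,…,R_n)` at `k = n` and to the constant `1` at
`k = 0`.  The rung `DiscRung k` says: every matrix-symmetric `VP` family `f` has square-symmetric circuits of
quasi-polynomial size computing `f_n · D_{k,n}^M` for some `M ≤ poly(n)` ("restoration up to the denominator
`D_k`").  PINNED ENDS (kernel-checked below): `DiscRung 0 ↔ ComplexRestorationQP ↔ MonotoneRestorationQP`, and
the crux implies every rung (`M = 0`).  Direction: SMALLER `k` is harder.

**Rung filed (θ₁ = co-rank 0, `k n = n`).** `stub_discRestoration : DiscRung id` — restoration up to the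
full marginal discriminant `Disc(R)·Disc(C)`.  PROVABLE NOW (not yet landed): the invariant field
`ℂ(x_ij)^{S_n × S_n}` is rational with the symmetric-cheap chart `Γ = (p_a(R), p_b(C), T_ab := Σ_ij R_i^a x_ij C_j^b)`
(Vandermonde/Lagrange inversion), Bläser–Jindal's Newton engine (BlaserJindal2019 Thm 4, the `S_n ↷ ℂ^n`
sibling where restoration IS a theorem) gives `f · Δ^{⌈d/2⌉} = A(Γ)` with `complexity A ≤ poly(s,n,d)`
(`BirationalWitness` below), and THEOREM ζ-G (`qpSymmetric_of_invariantGenerators`, p165179) turns the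
presentation into a square-symmetric circuit (`ChartSymmetric` below supplies the generator circuits).
Credit: the lever is the crux idea cards `discriminant-division` (ideator 2) and `label-discriminant-division`
(ideator 1) on stmt-ValiantsHypothesis-16191 (2026-08-16); this file TYPES their ladder `S(k)` in the crux's
currency, pins both ends by kernel theorems and registers it on stmt-15886.  Sanity run (this seat, exact
arithmetic, n = 2, see `Lines/disc_ladder_special.lean`): `per₂ ∉ ℚ[Γ]`, `per₂ · Δ ∈ ℚ[Γ]` (12 terms, kernel-checked
by `ring`), `(Σ x_ij²)·Δ ∈ ℚ[Γ]`, `(Π x_ij)·Δ ∉ ℚ[Γ]` but `(Π x_ij)·Δ² ∈ ℚ[Γ]` (exponent `⌈d/2⌉` sharp).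

**Ladder to the crux.** `stub_discDescent : DiscRung id → ∃ c, DiscRung (polylog_c)` — the DESCENT of the
denominator from co-rank 0 to co-rank `n − polylog` (milestones `CorankRung 1`, `CorankRung r`): this is the
crux-sized piece, in a new currency; `stub_averagedStrassen : (∃ c, DiscRung polylog_c) → ComplexRestorationQP`
— PROVABLE (Strassen's division elimination at a base point with `k` generic rows/columns and a constant bulk,
stabiliser index `n^{O(k)}`, then averaging the translated copies; `D_k` is non-zero there, whereas the full
discriminant `D_n` vanishes at EVERY point of quasi-polynomial stabiliser index — Dixon–Mortimer 5.2B — which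
is the located reason the θ₁ proof stops: Newton/Strassen are LOCAL and the fixed locus lies in `{D_n = 0}`).
Composition `MonotoneRestorationQP_of` is kernel-checked via THEOREM ε.

Honest ladder note (G4 (3)): between `DiscRung id` and `DiscRung polylog` the only typed waypoints are the
co-rank milestones; `stub_discDescent` is the passage down the ladder and is predicted summit-hard
(the crux implies it and, given the two provable stubs, is equivalent to it).
-/

set_option linter.dupNamespace false

namespace Summit.ValiantsHypothesis.ValiantsHypothesis.Cruxes.MonotoneRestorationQP.DiscLadder

open Summit.ValiantsHypothesis.ValiantsHypothesis.Theses.MonotoneRestoration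
open Summit.ValiantsHypothesis.ValiantsHypothesis.Theorems
open Literature.Computability.AlgebraicComplexity
open scoped BigOperators

noncomputable section

/-! ### The marginal power sums, the chart `Γ`, and the elementary discriminants -/

/-- Row sum `R_i = Σ_j x_ij`. -/
def rowSum (n : ℕ) (i : Fin n) : MvPolynomial (Fin n × Fin n) ℂ := ∑ j, MvPolynomial.X (i, j)

/-- Column sum `C_j = Σ_i x_ij`. -/
def colSum (n : ℕ) (j : Fin n) : MvPolynomial (Fin n × Fin n) ℂ := ∑ i, MvPolynomial.X (i, j)

/-- Power sum of the row sums `p_a(R) = Σ_i R_i^a`. -/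
def rowPsum (n a : ℕ) : MvPolynomial (Fin n × Fin n) ℂ := ∑ i, rowSum n i ^ a

/-- Power sum of the column sums `p_b(C) = Σ_j C_j^b`. -/
def colPsum (n b : ℕ) : MvPolynomial (Fin n × Fin n) ℂ := ∑ j, colSum n j ^ b

/-- Mixed Vandermonde moment `T_ab = Σ_ij R_i^a x_ij C_j^b` (the "Lagrange coordinates"). -/
def moment (n a b : ℕ) : MvPolynomial (Fin n × Fin n) ℂ :=
  ∑ i, ∑ j, rowSum n i ^ a * MvPolynomial.X (i, j) * colSum n j ^ b

/-- The birational chart `Γ_n = (p_{a+1}(R))_{a<n} ⊔ (p_{b+1}(C))_{b<n} ⊔ (T_ab)_{a,b<n}` of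
`ℂ(x_ij)^{S_n × S_n}` (n² + 2n matrix-symmetric generators; the relations `T_a0 = p_{a+1}(R)`,
`T_0b = p_{b+1}(C)` make `n²` of them a transcendence basis). -/
def chartGen (n : ℕ) : (Fin n ⊕ Fin n) ⊕ (Fin n × Fin n) → MvPolynomial (Fin n × Fin n) ℂ :=
  Sum.elim (Sum.elim (fun a => rowPsum n (a.val + 1)) (fun b => colPsum n (b.val + 1)))
    (fun ab => moment n ab.1.val ab.2.val)

/-- `k`-th elementary discriminant of the marginals:
`D_{k,n} = det (p_{a+b}(R))_{a,b<k} · det (p_{a+b}(C))_{a,b<k} = (Σ_{|S|=k} Disc(R_S)) · (Σ_{|S|=k} Disc(C_S))`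
(Cauchy–Binet).  `D_{0,n} = 1`, `D_{n,n} = Disc(R)·Disc(C)`, `D_{k,n} = 0` for `k > n`. -/
def hankelDisc (k n : ℕ) : MvPolynomial (Fin n × Fin n) ℂ :=
  (Matrix.of fun a b : Fin k => rowPsum n (a.val + b.val)).det *
    (Matrix.of fun a b : Fin k => colPsum n (a.val + b.val)).det

theorem hankelDisc_zero (n : ℕ) : hankelDisc 0 n = 1 := by
  simp [hankelDisc, Matrix.det_isEmpty]

/-! ### The graded family and its pinned ends -/

/-- Matrix symmetry of a family over `ℂ` (invariance under independent row and column permutations),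
verbatim as in THEOREM ε. -/
def IsMatSym (f : (n : ℕ) → MvPolynomial (Fin n × Fin n) ℂ) : Prop :=
  ∀ (n : ℕ) (σ τ : Equiv.Perm (Fin n)),
    MvPolynomial.rename (fun p : Fin n × Fin n => (σ p.1, τ p.2)) (f n) = f n

/-- `g` has a square-symmetric circuit over `ℂ` of size `≤ s`. -/
def SymComputes {n : ℕ} (g : MvPolynomial (Fin n × Fin n) ℂ) (s : ℕ) : Prop :=
  ∃ (G : Type) (_ : Fintype G) (C : LabelledArithCircuit ℂ (Fin n × Fin n) Unit G),
    C.IsSymmetric (Equiv.Perm (Fin n)) ∧ C.eval (C.output ()) = g ∧ Fintype.card G ≤ s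

/-- Complex matrix-symmetric restoration at quasi-polynomial cost — literally the right-hand side of
`monotoneRestorationQP_iff_complexRestorationQP` (THEOREM ε). -/
def ComplexRestorationQP : Prop :=
  ∀ f : (n : ℕ) → MvPolynomial (Fin n × Fin n) ℂ, IsMatSym f → IsVPFamily f →
    ∃ c : ℕ, ∀ n : ℕ, ∃ (G : Type) (_ : Fintype G)
      (C : LabelledArithCircuit ℂ (Fin n × Fin n) Unit G),
      C.IsSymmetric (Equiv.Perm (Fin n)) ∧ C.eval (C.output ()) = f n ∧
        Fintype.card G ≤ 2 ^ ((Nat.log 2 n + c) ^ c)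

/-- **The graded family (rung decl).** `DiscRung k`: RESTORATION UP TO THE DENOMINATOR `D_k` — every
matrix-symmetric `VP` family `f` over `ℂ` has, for every `n`, a square-symmetric circuit of size
`≤ 2^((log₂ n + c)^c)` computing `f_n · D_{k(n),n}^M` for some `M ≤ (n+2)^c`. -/
def DiscRung (k : ℕ → ℕ) : Prop :=
  ∀ f : (n : ℕ) → MvPolynomial (Fin n × Fin n) ℂ, IsMatSym f → IsVPFamily f →
    ∃ c : ℕ, ∀ n : ℕ, ∃ M : ℕ, M ≤ (n + 2) ^ c ∧
      SymComputes (f n * hankelDisc (k n) n ^ M) (2 ^ ((Nat.log 2 n + c) ^ c))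

/-- Co-rank milestones of the ladder: `CorankRung r = DiscRung (n ↦ n − r)` (denominator non-zero iff
`≥ n − r` distinct row sums and `≥ n − r` distinct column sums).  `CorankRung 0 = DiscRung id` is the rung
filed; `CorankRung 1` is the next waypoint (one marginal collision: residual Young subgroup `S₂`,
secondary invariants of bounded cost à la Dahan–Schost–Wu). -/
def CorankRung (r : ℕ) : Prop := DiscRung fun n => n - r

/-- The polylogarithmic rung reached by averaged Strassen division. -/
def PolylogRung (c : ℕ) : Prop := DiscRung fun n => (Nat.log 2 n + c) ^ c

/-- TOP PINNED: the `k = 0` rung is complex restoration itself (`D_0 = 1`). -/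
theorem discRung_zero_iff : DiscRung (fun _ => 0) ↔ ComplexRestorationQP := by
  constructor
  · intro h f hs hv
    obtain ⟨c, hc⟩ := h f hs hv
    refine ⟨c, fun n => ?_⟩
    obtain ⟨M, -, G, i, C, h1, h2, h3⟩ := hc n
    exact ⟨G, i, C, h1, by simpa [hankelDisc_zero] using h2, h3⟩
  · intro h f hs hv
    obtain ⟨c, hc⟩ := h f hs hv
    refine ⟨c, fun n => ⟨0, Nat.zero_le _, ?_⟩⟩
    obtain ⟨G, i, C, h1, h2, h3⟩ := hc n
    exact ⟨G, i, C, h1, by simpa [hankelDisc_zero] using h2, h3⟩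

/-- TOP = CRUX (THEOREM ε by name). -/
theorem complexRestorationQP_iff_crux : ComplexRestorationQP ↔ MonotoneRestorationQP :=
  monotoneRestorationQP_iff_complexRestorationQP.symm

/-- ON-PATH: the crux implies every rung (take `M = 0`). -/
theorem discRung_of_crux (hC : MonotoneRestorationQP) (k : ℕ → ℕ) : DiscRung k := by
  intro f hs hv
  obtain ⟨c, hc⟩ := (complexRestorationQP_iff_crux.mpr hC) f hs hv
  refine ⟨c, fun n => ⟨0, Nat.zero_le _, ?_⟩⟩
  obtain ⟨G, i, C, h1, h2, h3⟩ := hc n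
  exact ⟨G, i, C, h1, by simpa using h2, h3⟩

/-! ### The rung's own skeleton (typed; proof of `DiscRung id` = ζ-G ∘ these two) -/

/-- **BirationalWitness (Bläser–Jindal transplanted along `Γ`).** Every matrix-symmetric `VP` family satisfies
`f_n · (Disc R · Disc C)^M = A_n(Γ_n)` with `complexity A_n ≤ poly(n)` and `M ≤ poly(n)`.
Proof route: Vandermonde inversion `X = V_R^{-ᵀ} T V_C^{-1}` shows `ℂ(x)^{S_n×S_n} = ℂ(Γ)`; algebraic Newton
iteration at a generic base point (BlaserJindal2019 §3, all divisions by constants) computes the truncated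
Taylor series of `A = (f Δ^M) ∘ Γ^{-1}`, exact by algebraic independence of `Γ`. [conjecture: this line, S1a] -/
def BirationalWitness : Prop :=
  ∀ f : (n : ℕ) → MvPolynomial (Fin n × Fin n) ℂ, IsMatSym f → IsVPFamily f →
    ∃ c : ℕ, ∀ n : ℕ, ∃ M : ℕ, M ≤ (n + 2) ^ c ∧
      ∃ A : MvPolynomial ((Fin n ⊕ Fin n) ⊕ (Fin n × Fin n)) ℂ,
        complexity A ≤ (n + 2) ^ c ∧ MvPolynomial.aeval (chartGen n) A = f n * hankelDisc n n ^ M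

/-- **ChartSymmetric.** Every chart generator has a square-symmetric circuit of polynomial size
(row/column-sum gates of orbit `n`, their powers, products `R_i^a x_ij C_j^b` of orbit `n²`, sums).
[conjecture: this line, S1b — routine with the ζ size calculus] -/
def ChartSymmetric : Prop :=
  ∃ c : ℕ, ∀ (n : ℕ) (ι : (Fin n ⊕ Fin n) ⊕ (Fin n × Fin n)), SymComputes (chartGen n ι) ((n + 2) ^ c)

/-! ### Registered stubs and the kernel-checked composition -/

/-- S1 — THE RUNG (θ₁ = co-rank 0): restoration up to the full marginal discriminant.  Provable now:
`BirationalWitness` + `ChartSymmetric` + `qpSymmetric_of_invariantGenerators` (THEOREM ζ-G). -/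
theorem stub_discRestoration : DiscRung id := by
  sorry

/-- S2 — THE DESCENT (crux-sized, new currency): push the denominator from co-rank 0 down to a
polylogarithmic elementary discriminant.  Waypoints: `CorankRung 1`, `CorankRung r`. -/
theorem stub_discDescent : DiscRung id → ∃ c : ℕ, PolylogRung c := by
  sorry

/-- S3 — AVERAGED STRASSEN DIVISION (provable): `D_k` with `k = polylog` is non-zero at a base point of
stabiliser index `n^{O(k)}`; Strassen's division elimination at that point is `Stab`-symmetric, and the
average of the `n^{O(k)}` translated copies is a square-symmetric circuit for `f_n`. -/
theorem stub_averagedStrassen : (∃ c : ℕ, PolylogRung c) → ComplexRestorationQP := by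
  sorry

/-- **Cone of the line** (documentation form): the three stub STATEMENTS imply the crux, via THEOREM ε by name. -/
theorem crux_of_rungs :
    DiscRung id →
    (DiscRung id → ∃ c : ℕ, PolylogRung c) →
    ((∃ c : ℕ, PolylogRung c) → ComplexRestorationQP) →
    ComplexRestorationQP :=
  fun h₁ h₂ h₃ => h₃ (h₂ h₁)

/-- **Skeleton theorem** (registered shape: concludes the crux BY NAME, no hypotheses, sorries only inside the three
declared stubs): `MonotoneRestorationQP` from `stub_discRestoration`, `stub_discDescent`, `stub_averagedStrassen`
and THEOREM ε (`monotoneRestorationQP_iff_complexRestorationQP`, p155888). -/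
theorem MonotoneRestorationQP_of : MonotoneRestorationQP :=
  complexRestorationQP_iff_crux.mp
    (crux_of_rungs stub_discRestoration stub_discDescent stub_averagedStrassen)

end

end Summit.ValiantsHypothesis.ValiantsHypothesis.Cruxes.MonotoneRestorationQP.DiscLadder
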